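import Literature.NumberTheory.Rogawski1990.XiLocalCharacter                 -- ★ `OneDimAutRepH.xiLocalChar`, `continuous_xiLocalChar`
import Literature.NumberTheory.Rogawski1990.LocalTransferGlueCM              -- ★ `totallyDisconnectedSpace_cmDatum_local` (F0P2-p02 (g8))
import Literature.NumberTheory.Automorphic.LocalUnitaryIntegralLevel         -- ★ `cmLocalIntegralLevel`, `isCompact_isOpen_cmLocalIntegralLevel`
import Literature.GroupTheory.PiCharacterFactorsFinitely                     -- ★ `isOpen_ker_units_complex` (profinite `G`, no small subgroups in `ℂˣ`)
import HarnessLib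

/-!
# (N) DEFS rider — `ξ_v` HAS OPEN KERNEL: `IsOpen (ker (ξ.xiLocalChar v))` (discharges the `hχ` hypothesis of ★ FILE 3c `GlobalPacketH.charPacket` ∕ FILE 1c
# `packetHOfChar` at `χ v := ξ.xiLocalChar v`), via a generic lemma: a continuous `ℂˣ`-valued character of a totally disconnected group with a compact open subgroup
# has open kernel

Cell `hodgecm-mathlib` (D-0151), F0∕P3 «U3-mult», crux H413 (`stmt-HodgeConjecture-24833`).  F0P2-p01 (g9) knock #5 offer (d) (census: tokens ★ —
`isOpen_ker_units_complex` (profinite), `isCompact_isOpen_cmLocalIntegralLevel`, `totallyDisconnectedSpace_cmDatum_local`, `continuous_xiLocalChar`).  KERNEL lane, THEOREMS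
ONLY (no `def`, no instance, no notation, no named fact, no `sorry`); `--supports stmt-HodgeConjecture-24833 --as helper`.
HONEST LABEL: HC_CM is proved only modulo the printed citations until rung 0 closes; this file is generic topology∕harmonic analysis and moves no count.

THE MATHEMATICS ([BushnellHenniart2006, §1.5]: characters of locally profinite groups are smooth; folklore «`ℂˣ` has no small subgroups»).  Let `G` be a topological group,
totally disconnected, with a compact open subgroup `K`, and `c : G →* ℂˣ` continuous.  Then `K` is profinite, so `c|_K` has open kernel in `K` (★ `isOpen_ker_units_complex`);
its image in `G` is open (`K ↪ G` is an open embedding) and lies in `ker c`, so `ker c` is open (`Subgroup.isOpen_mono`).  For `H_v = U(Φ₂)(L⁺_v) × U(Φ₁)(L⁺_v)` take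
`K = K_{2,v} × K_{1,v}` (★ `cmLocalIntegralLevel`, compact open) and `c = ξ_v` (★ `continuous_xiLocalChar`).

* `isOpen_ker_of_continuous_of_isCompact_isOpen_subgroup` (generic) · `isOpen_ker_xiLocalChar` (the CM instance).

References: [BushnellHenniart2006] §1.5; [Rogawski1990] §12.1 (one-dimensional `ξ_v`).
-/

set_option autoImplicit false
-- the mandated namespace repeats `HodgeConjecture.HodgeConjecture`, as in every `Theorems/*.lean` of this sub-problem
set_option linter.dupNamespace false

noncomputable section

open NumberField IsDedekindDomain Topology

namespace Summit.HodgeConjecture.HodgeConjecture.Cruxes.H413.F0P3XiLocalCharOpenKernel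

open Literature.NumberTheory Literature.NumberTheory.Automorphic Literature.NumberTheory.Automorphic.UnitaryGroup
open Literature.NumberTheory.Rogawski1990 Literature.NumberTheory.GaloisRepresentations
open Literature.GroupTheory.PiCharacter

/-! ## §1 Generic: continuous `ℂˣ`-characters of a group with a compact open subgroup have open kernel -/

/-- **A continuous character `c : G →* ℂˣ` of a totally disconnected topological group with a compact open subgroup `K` has OPEN KERNEL**
(`c|_K` kills an open subgroup of the profinite `K` — ★ `isOpen_ker_units_complex` — whose image is open in `G`). [cite: BushnellHenniart2006, §1.5] -/
theorem isOpen_ker_of_continuous_of_isCompact_isOpen_subgroup {G : Type*} [Group G] [TopologicalSpace G] [IsTopologicalGroup G]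
    [TotallyDisconnectedSpace G] (K : Subgroup G) (hKc : IsCompact (K : Set G)) (hKo : IsOpen (K : Set G))
    (c : G →* ℂˣ) (hc : Continuous c) : IsOpen ((c.ker : Subgroup G) : Set G) := by
  haveI : CompactSpace K := isCompact_iff_compactSpace.mp hKc
  have hK : IsOpen (((c.comp K.subtype).ker : Subgroup K) : Set K) :=
    Literature.GroupTheory.PiCharacter.isOpen_ker_units_complex (c.comp K.subtype) (hc.comp continuous_subtype_val)
  have hle : ((c.comp K.subtype).ker.map K.subtype : Subgroup G) ≤ c.ker := by
    rintro _ ⟨x, hx, rfl⟩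
    simpa [MonoidHom.mem_ker] using hx
  refine Subgroup.isOpen_mono hle ?_
  have himg : ((((c.comp K.subtype).ker.map K.subtype : Subgroup G)) : Set G) =
      Subtype.val '' ((((c.comp K.subtype).ker : Subgroup K)) : Set K) := by
    ext x
    simp only [Subgroup.coe_map, Subgroup.coe_subtype]
  rw [himg]
  exact hKo.isOpenEmbedding_subtypeVal.isOpenMap _ hK

/-! ## §2 The CM instance: `ξ_v` on `H_v = U(Φ₂)(L⁺_v) × U(Φ₁)(L⁺_v)` -/

variable (L : Type) [Field L] [NumberField L] [IsCMField L]

/-- **`ξ_v` has open kernel** (so ★ `SmoothIrrep.ofChar (ξ.xiLocalChar v) _` and ★ FILE 1c `packetHOfChar … (ξ.xiLocalChar v) _` need no extra hypothesis).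
[cite: BushnellHenniart2006, §1.5] [cite: Rogawski1990, §12.1 p. 171] -/
theorem isOpen_ker_xiLocalChar (ξ : OneDimAutRepH L) (v : HeightOneSpectrum (𝓞 ↥(maximalRealSubfield L))) :
    IsOpen (((ξ.xiLocalChar v).ker : Subgroup
      ((UnitaryGroup.cmDatum L 2 (Matrix.of fun i j : Fin 2 => if i.val + j.val + 1 = 2 then (1 : L) else 0)).Local v ×
        (UnitaryGroup.cmDatum L 1 (Matrix.of fun i j : Fin 1 => if i.val + j.val + 1 = 1 then (1 : L) else 0)).Local v)) :
      Set ((UnitaryGroup.cmDatum L 2 (Matrix.of fun i j : Fin 2 => if i.val + j.val + 1 = 2 then (1 : L) else 0)).Local v ×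
        (UnitaryGroup.cmDatum L 1 (Matrix.of fun i j : Fin 1 => if i.val + j.val + 1 = 1 then (1 : L) else 0)).Local v)) := by
  haveI := totallyDisconnectedSpace_cmDatum_local L 2 (Matrix.of fun i j : Fin 2 => if i.val + j.val + 1 = 2 then (1 : L) else 0) v
  haveI := totallyDisconnectedSpace_cmDatum_local L 1 (Matrix.of fun i j : Fin 1 => if i.val + j.val + 1 = 1 then (1 : L) else 0) v
  have h2 := isCompact_isOpen_cmLocalIntegralLevel L 2 (Matrix.of fun i j : Fin 2 => if i.val + j.val + 1 = 2 then (1 : L) else 0) v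
  have h1 := isCompact_isOpen_cmLocalIntegralLevel L 1 (Matrix.of fun i j : Fin 1 => if i.val + j.val + 1 = 1 then (1 : L) else 0) v
  refine isOpen_ker_of_continuous_of_isCompact_isOpen_subgroup
    ((cmLocalIntegralLevel L 2 (Matrix.of fun i j : Fin 2 => if i.val + j.val + 1 = 2 then (1 : L) else 0) v).prod
      (cmLocalIntegralLevel L 1 (Matrix.of fun i j : Fin 1 => if i.val + j.val + 1 = 1 then (1 : L) else 0) v))
    ?_ ?_ (ξ.xiLocalChar v) (Units.isEmbedding_val₀.continuous_iff.2 (OneDimAutRepH.continuous_xiLocalChar ξ v))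
  · simpa [Subgroup.coe_prod] using h2.1.prod h1.1
  · simpa [Subgroup.coe_prod] using h2.2.prod h1.2

end Summit.HodgeConjecture.HodgeConjecture.Cruxes.H413.F0P3XiLocalCharOpenKernel

end
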